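import Literature.Analysis.FluidPDE.Tao2016AveragedNS.SplitCascadeRescaledWindowCert
import Literature.Analysis.FluidPDE.Tao2016AveragedNS.SplitCascadeRescaledExit
import Literature.Analysis.FluidPDE.TaoCascadeReducedClaim
import HarnessLib

/-!
# The split Prop. 6.5: the bootstrap time `T₁` (port of the pointwise part of `TaoCascadeReducedClaim`)

T. Tao, *Finite time blowup for an averaged three-dimensional Navier–Stokes equation*,
arXiv:1402.0290v3, §6.5 (the time `T₁`, Lemma 6.8, Cor. 6.11).
HONEST FRAMING: statements about the SPLIT cascade model system; nothing here proves the split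
Prop. 6.5 and nothing here concerns the true Navier–Stokes equations.

`isBootstrapTime_T1` is the tree's theorem by renaming (`GoodAt` at `0` and Cor. 6.11 at `T₁` as
hypotheses). New for the split system: `exitTrichotomy_T1_of_profile` — Cor. 6.11♯ at `T₁`
(`SplitCascadeRescaledExit.exit_trichotomy`) needs a bound `|Z̃_{d,1}| ≤ ζ`, `ζ² ≤ ¼K⁻²⁰` on `[0, T₁]`;
it is supplied by the window certificate `SplitCascadeRescaledWindowCert.absW_le_windowLevel` from
the profile at the checkpoint (`|Z̃_{i,k}(0)| ≤ η`, `k ∈ {-1,0,1}`) and `GoodAt` on `[0, T₁]`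
(`goodAt_of_mem_T1`), under the smallness `windowLevel(…, η)² ≤ ¼K⁻²⁰` (a condition on `(η, n₀)`);
`isBootstrapTime_T1_of_profile` combines the two.

## References

* T. Tao, arXiv:1402.0290v3, §6.5 Lemma 6.8, Cor. 6.11. [`Tao2016AveragedNS`]
-/

noncomputable section

open Set MeasureTheory intervalIntegral

namespace Literature.Analysis.FluidPDE

namespace Tao2016AveragedNS

open TaoCascade

section Pointwise

variable {γ ε₀ K ε C₁ C₂ C₃ : ℝ} {n₀ N : ℤ} {ηp : ℤ → ℝ} {βp : ℕ → ℝ} {τ : ℤ → ℝ}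
  {Xr : Fin 4 → ℤ → ℝ → ℝ} {W : Fin 3 → ℤ → ℝ → ℝ} {Er : ℤ → ℝ → ℝ}

/-- **`T₁` is a bootstrap time as soon as Cor. 6.11 holds at `T₁`** (with `GoodAt` at `0`, `K ≥ 2`):
`GoodAt` holds on `[0, T₁]`, `T₁ ≤ 100`, and `T₁ > 0` because at `t = 0` the exits (6.101), (6.102)
are excluded by the strict initial bounds of Lemma 6.8 (`Ẽ₋₁(0) ≤ (1+ε₀)^{-2/25} K⁻¹⁰ (1+ε₀)^{1/5}`,
`|d₁(0)| ≤ √2 K⁻¹⁵ < ½ K⁻¹⁰`) ("from Lemma 6.8 we see that `T₁ ≠ 0`, thus `0 < T₁ ≤ 100`").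
[cite: Tao2016AveragedNS, §6.5, paragraph before Lemma 6.10] -/
theorem RescaledSplitHypotheses.isBootstrapTime_T1
    (h : RescaledSplitHypotheses γ ε₀ K ε C₁ C₂ C₃ n₀ N ηp βp τ Xr W Er) (hε₀ : 0 < ε₀) (hK : 2 ≤ K)
    (hN : n₀ ≤ N) (h0 : GoodAt ε₀ K Xr Er 0)
    (hexit : ExitTrichotomy ε₀ K Xr Er (T1 ε₀ K Xr Er)) :
    IsBootstrapTime ε₀ K Xr Er (T1 ε₀ K Xr Er) := by
  have hq0 : (0 : ℝ) < 1 + ε₀ := by linarith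
  have hq1 : (1 : ℝ) < 1 + ε₀ := by linarith
  have hK0 : 0 < K := by linarith
  have hK1 : 1 ≤ K := by linarith
  have hmem := T1_mem h0
  refine ⟨?_, hmem.2, fun t ht => h.goodAt_of_mem_T1 hN h0 ht, hexit⟩
  rcases eq_or_lt_of_le hmem.1 with h0T | h0T
  · exfalso
    rcases hexit with h1 | h2 | h3
    · -- `Ẽ₋₁(0) < K⁻¹⁰ (1+ε₀)^{1/5}`
      rw [← h0T] at h1
      have hb := h.energy_zero_before hε₀ hK1 hN 2 le_rfl
      have hi : (1 : ℤ) - ((2 : ℕ) : ℤ) = -1 := by norm_num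
      have hc : (((2 : ℕ) : ℝ)) / 10 = (1 : ℝ) / 5 := by norm_num
      rw [hi, hc, h1] at hb
      have hlt : (1 + ε₀) ^ (-(2 : ℝ) / 25) < 1 :=
        Real.rpow_lt_one_of_one_lt_of_neg hq1 (by norm_num)
      have hp : 0 < (K ^ 10)⁻¹ * (1 + ε₀) ^ ((1 : ℝ) / 5) := by positivity
      nlinarith
    · -- `|d₁(0)| ≤ √2 K⁻¹⁵ < ½ K⁻¹⁰`
      rw [← h0T] at h2
      have hd := h.abs_d_one_zero_le hε₀ hK0 hN
      rw [h2] at hd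
      have hK5pos : 0 < K ^ 5 := by positivity
      have hK10 : 0 < (K ^ 10)⁻¹ := by positivity
      have : 1 / 2 * (K ^ 10)⁻¹ ≤ Real.sqrt 2 * (K ^ 5)⁻¹ * (K ^ 10)⁻¹ := by
        calc 1 / 2 * (K ^ 10)⁻¹ ≤ Real.sqrt 2 * (K ^ 15)⁻¹ := hd
          _ = Real.sqrt 2 * (K ^ 5)⁻¹ * (K ^ 10)⁻¹ := by
              rw [show K ^ 15 = K ^ 5 * K ^ 10 by ring, mul_inv, mul_assoc]
      have h' : 1 / 2 ≤ Real.sqrt 2 * (K ^ 5)⁻¹ := le_of_mul_le_mul_right this hK10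
      rw [← div_eq_mul_inv, le_div_iff₀ hK5pos] at h'
      have hs : Real.sqrt 2 < 3 / 2 := (Real.sqrt_lt' (by norm_num)).2 (by norm_num)
      have hK5 : (32 : ℝ) ≤ K ^ 5 := by
        calc (32 : ℝ) = 2 ^ 5 := by norm_num
          _ ≤ K ^ 5 := pow_le_pow_left₀ (by norm_num) hK 5
      nlinarith
    · norm_num [← h0T] at h3
  · exact h0T


/-- **Cor. 6.11♯ at `T₁` from the profile**: under the largeness hypotheses of
`SplitCascadeRescaledExit.exit_trichotomy`, the `a`-asymmetry profile bound `η(0) ≤ 10⁻³`, the profile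
`|Z̃_{i,k}(0)| ≤ η_m` (`k ∈ {-1,0,1}`) and the smallness `windowLevel(ε₀,K,ε,C₁,n₀,η_m)² ≤ ¼K⁻²⁰`, the
exit trichotomy holds at `T₁`. [cite: Tao2016AveragedNS, §6.5 Cor. 6.11] -/
theorem RescaledSplitHypotheses.exitTrichotomy_T1_of_profile
    (h : RescaledSplitHypotheses γ ε₀ K ε C₁ C₂ C₃ n₀ N ηp βp τ Xr W Er) (hε₀ : 0 < ε₀) (hε₀1 : ε₀ < 1)
    (hγ1 : γ ≤ 1 / 10 ^ 5) (hK : 2 ≤ K) (hKε : 10 ^ 8 ≤ ε₀ * K ^ 4) (hε : 0 < ε) (hε1 : ε ≤ 1)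
    (hC₁ : 0 ≤ C₁) (hC₂ : 0 ≤ C₂) (hC₃ : 0 ≤ C₃) (hN : n₀ ≤ N)
    (hn : C₂ * (1 + ε₀) ^ (-(n₀ : ℝ) / 2) * cumEnergyConst ε₀ C₃ ≤ 1 / 100)
    (hη0 : ηp 0 ≤ 1 / 10 ^ 3) {ηm : ℝ}
    (hη : ∀ i : Fin 3, |W i (-1) 0| ≤ ηm ∧ |W i 0 0| ≤ ηm ∧ |W i 1 0| ≤ ηm)
    (hζK : windowLevel ε₀ K ε C₁ n₀ ηm ^ 2 ≤ 1 / 4 * (K ^ 20)⁻¹) :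
    ExitTrichotomy ε₀ K Xr Er (T1 ε₀ K Xr Er) := by
  have hK0 : 0 < K := by linarith
  have hK1 : 1 ≤ K := by linarith
  have g0 := h.goodAt_zero hε₀ hε₀1 hγ1 hK hε hε1 hC₂ hC₃ hN hn hη0
  have hmem := T1_mem g0
  have hgood : ∀ t ∈ Icc 0 (T1 ε₀ K Xr Er), GoodAt ε₀ K Xr Er t := fun t ht =>
    h.goodAt_of_mem_T1 hN g0 ht
  have hζ : ∀ t ∈ Icc 0 (T1 ε₀ K Xr Er), |W 2 1 t| ≤ windowLevel ε₀ K ε C₁ n₀ ηm := fun t ht =>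
    h.absW_le_windowLevel hε₀ hε₀1 hε hK1 hC₁ (h.tau_init_le hN) hmem.2 hgood hη ht 2
      (Or.inr (Or.inr rfl))
  have hex := h.exit_trichotomy hε₀ hε₀1 hγ1 hK0 hKε hε hε1 hC₂ hC₃ hN hn hη0 hζ hζK
  have e : ((2 : ℝ) / 10) = (1 : ℝ) / 5 := by norm_num
  rw [e] at hex
  exact hex

/-- **`T₁` is a bootstrap time, from the profile** (`isBootstrapTime_T1` with its two hypotheses
discharged by Lemma 6.8♯ and Cor. 6.11♯). [cite: Tao2016AveragedNS, §6.5] -/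
theorem RescaledSplitHypotheses.isBootstrapTime_T1_of_profile
    (h : RescaledSplitHypotheses γ ε₀ K ε C₁ C₂ C₃ n₀ N ηp βp τ Xr W Er) (hε₀ : 0 < ε₀) (hε₀1 : ε₀ < 1)
    (hγ1 : γ ≤ 1 / 10 ^ 5) (hK : 2 ≤ K) (hKε : 10 ^ 8 ≤ ε₀ * K ^ 4) (hε : 0 < ε) (hε1 : ε ≤ 1)
    (hC₁ : 0 ≤ C₁) (hC₂ : 0 ≤ C₂) (hC₃ : 0 ≤ C₃) (hN : n₀ ≤ N)
    (hn : C₂ * (1 + ε₀) ^ (-(n₀ : ℝ) / 2) * cumEnergyConst ε₀ C₃ ≤ 1 / 100)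
    (hη0 : ηp 0 ≤ 1 / 10 ^ 3) {ηm : ℝ}
    (hη : ∀ i : Fin 3, |W i (-1) 0| ≤ ηm ∧ |W i 0 0| ≤ ηm ∧ |W i 1 0| ≤ ηm)
    (hζK : windowLevel ε₀ K ε C₁ n₀ ηm ^ 2 ≤ 1 / 4 * (K ^ 20)⁻¹) :
    IsBootstrapTime ε₀ K Xr Er (T1 ε₀ K Xr Er) :=
  h.isBootstrapTime_T1 hε₀ hK hN (h.goodAt_zero hε₀ hε₀1 hγ1 hK hε hε1 hC₂ hC₃ hN hn hη0)
    (h.exitTrichotomy_T1_of_profile hε₀ hε₀1 hγ1 hK hKε hε hε1 hC₁ hC₂ hC₃ hN hn hη0 hη hζK)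

end Pointwise

end Tao2016AveragedNS

end Literature.Analysis.FluidPDE
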